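import Literature.AlgebraicTopology.Homotopy.SerreFibrationCell
import Literature.AlgebraicTopology.Homotopy.StrongDeformationRetractSqueeze
import Literature.AlgebraicTopology.SingularHomology.KroneckerDualMap
import Literature.AlgebraicTopology.SingularHomology.WeakEquivalenceHomology
import Literature.AlgebraicTopology.SingularHomology.CohomologyMayerVietorisExtend
import Literature.AlgebraicTopology.SingularHomology.CohomologyDisjointOpenCover
import Literature.AlgebraicTopology.SingularHomology.TripleSequence
import Mathlib.Analysis.Convex.Contractible
import HarnessLib

/-!
# Flat families of fibre classes over a Serre fibration: rigidity along paths, gluing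

Topic `Literature/AlgebraicTopology/Homotopy`. For a Serre fibration `p : E → B` and a field `K`, a
family `y_b ∈ Hᵏ(p⁻¹b; K)` of cohomology classes of the fibres is *flat* (a continuous section of
the local system `Rᵏ p_* K`, Voisin II §4.3.1 / Voisin I §9.2.1) when every point has a
neighbourhood `V` and a class on `p⁻¹V` restricting to `y_b` for all `b ∈ V`. This file proves the
elementary facts about such families that the topological form of Deligne's invariant cycle theorem
(`SerreFibrationInvariantCycles.lean`) uses:

* `bijective_cohomologyMap_of_isWeakHomotopyEquiv` — a weak homotopy equivalence induces
  bijections on `Hᵏ(-; K)` (Spanier 7.6.25 in homology, dualised over the field);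
  `bijective_res_of_isWeakHomotopyEquiv`, `…_of_isStrongDeformationRetractOf`,
  `bijective_res_singleton` — hence so does `p⁻¹S ↪ p⁻¹T` over a weak equivalence of sub-bases
  (Spanier 9.2.17), in particular a fibre `p⁻¹b ↪ p⁻¹T` over a contractible `T`.
* `isWeakHomotopyEquiv_fibre_pullback` — the fibre includes into the pullback of `p` along a map
  from a contractible space by a weak equivalence.
* `propagate` — **rigidity of flat families along paths**: if a class `z ∈ Hᵏ(p⁻¹C; K)` restricts
  to `y_b` on ONE fibre of a path in `C`, it does so on every fibre of the path (pull `p` back along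
  short sub-paths, over which all fibres include by weak equivalences). This is the statement that a
  section of the local system `Rᵏ p_* K` vanishing at a point vanishes on its path component
  (Voisin I §9.2.1, Voisin II §4.3.1 before Lemma 4.17).
* `exists_of_res_eq_res`, `eq_zero_of_forall_res_eq_zero`, `exists_forall_res_eq` — Mayer–Vietoris
  gluing and clopen additivity for classes on subsets of an ambient space (wrappers of the tree's
  `singularCohomology.exists_of_map_inclusion_eq`, `piRestrict_bijective`).
* `range_cohomologyMap_eq_of_ker_eq` — over a field, `range f^* = range g^*` on `Hᵏ` as soon as
  `ker f_* = ker g_*` on `Hₖ` (Kronecker duality, Hatcher Thm. 3.2 / p. 201).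

Everything is proved; no named fact.

## References

* E. H. Spanier, *Algebraic Topology*, Springer (1981), Ch. 7 Sec. 6 Thm. 25; Ch. 9 Sec. 2 Thm. 17.
  [Spanier1981]
* C. Voisin, *Hodge Theory and Complex Algebraic Geometry I*, CUP (2002), §9.2.1. [VoisinHodgeI2002]
* C. Voisin, *Hodge Theory and Complex Algebraic Geometry II*, CUP (2003), §4.3.1. [VoisinHodgeII2003]
* A. Hatcher, *Algebraic Topology*, CUP (2002), §3.1 Thm. 3.2, pp. 201–204. [HatcherAT2002]
-/

noncomputable section

open Set Function Metric CategoryTheory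
open scoped Topology unitInterval
open Literature.AlgebraicTopology.SingularHomology

namespace Literature.AlgebraicTopology.Homotopy

universe u v w

namespace SerreFlat

/-! ### Cohomology along weak homotopy equivalences -/

section WeakEquiv

variable (K : Type v) [Field K]

/-- A `ModuleCat` isomorphism is a bijection. [folklore] -/
theorem bijective_hom_of_isIso {R : Type w} [Ring R] {M N : ModuleCat.{v} R} (f : M ⟶ N) [IsIso f] :
    Bijective f.hom :=
  (asIso f).toLinearEquiv.bijective

/-- **A weak homotopy equivalence induces bijections on `Hᵏ(-; K)`** for a field `K` (Spanier
7.6.25 for homology; Kronecker duality over the field). [cite: Spanier1981, Ch. 7, Sec. 6, Thm. 25]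
[cite: HatcherAT2002, §3.1 Thm. 3.2 and p. 201] -/
theorem bijective_cohomologyMap_of_isWeakHomotopyEquiv {X Y : Type u} [TopologicalSpace X]
    [TopologicalSpace Y] (f : C(X, Y)) (hf : IsWeakHomotopyEquiv f) (k : ℕ) :
    Bijective (singularCohomology.map K K f k) := by
  rw [singularCohomology_map_bijective_iff_of_field K f k]
  haveI := isIso_singularHomology_map_of_isWeakHomotopyEquiv K f hf k
  exact bijective_hom_of_isIso (singularHomology.map K K f k)

/-- A homeomorphism induces bijections on `Hᵏ(-; K)`. [folklore] -/
theorem bijective_cohomologyMap_homeomorph {X Y : Type u} [TopologicalSpace X] [TopologicalSpace Y]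
    (e : X ≃ₜ Y) (k : ℕ) : Bijective (singularCohomology.map K K (e : C(X, Y)) k) :=
  bijective_cohomologyMap_of_isWeakHomotopyEquiv K _ (IsWeakHomotopyEquiv.of_homeomorph e) k

/-- `e^* (e⁻¹)^* = id`. [folklore] -/
theorem map_homeomorph_map_symm {X Y : Type u} [TopologicalSpace X] [TopologicalSpace Y]
    (e : X ≃ₜ Y) (k : ℕ) (a : singularCohomology K K X k) :
    singularCohomology.map K K (e : C(X, Y)) k (singularCohomology.map K K (e.symm : C(Y, X)) k a) = a := by
  rw [← ModuleCat.comp_apply, ← singularCohomology.map_comp]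
  have h : (e.symm : C(Y, X)).comp (e : C(X, Y)) = ContinuousMap.id X :=
    ContinuousMap.ext fun x => e.symm_apply_apply x
  rw [h, singularCohomology.map_id]
  rfl

/-- `(e⁻¹)^* e^* = id`. [folklore] -/
theorem map_symm_map_homeomorph {X Y : Type u} [TopologicalSpace X] [TopologicalSpace Y]
    (e : X ≃ₜ Y) (k : ℕ) (a : singularCohomology K K Y k) :
    singularCohomology.map K K (e.symm : C(Y, X)) k (singularCohomology.map K K (e : C(X, Y)) k a) = a :=
  map_homeomorph_map_symm K e.symm k a

variable {E : Type u} {B : Type w} [TopologicalSpace E] [TopologicalSpace B] {p : E → B}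

omit [TopologicalSpace E] [TopologicalSpace B] in
/-- A fibre lies in the preimage of any set containing its base point. [folklore] -/
theorem fibre_subset_preimage {C : Set B} {b : B} (hb : b ∈ C) : p ⁻¹' {b} ⊆ p ⁻¹' C :=
  preimage_mono (singleton_subset_iff.2 hb)

/-- **Over a weak equivalence of sub-bases `S ↪ T`, restriction `Hᵏ(p⁻¹T) → Hᵏ(p⁻¹S)` is
bijective** (Spanier 9.2.17: `p⁻¹S ↪ p⁻¹T` is a weak equivalence).
[cite: Spanier1981, Ch. 9, Sec. 2, Thm. 17] -/
theorem bijective_res_of_isWeakHomotopyEquiv (hp : IsSerreFibration p) {S T : Set B} (hST : S ⊆ T)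
    (hw : IsWeakHomotopyEquiv (subsetInclusion hST)) (k : ℕ) :
    Bijective (singularCohomology.map K K
      (subsetInclusion (preimage_mono hST : p ⁻¹' S ⊆ p ⁻¹' T)) k) :=
  bijective_cohomologyMap_of_isWeakHomotopyEquiv K _ (hp.isWeakHomotopyEquiv_preimage_inclusion hST hw) k

/-- Restriction `Hᵏ(p⁻¹T) → Hᵏ(p⁻¹S)` is bijective when `S` is a strong deformation retract of `T`.
[cite: Spanier1981, Ch. 9, Sec. 2, Thm. 17] -/
theorem bijective_res_of_isStrongDeformationRetractOf (hp : IsSerreFibration p) {S T : Set B}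
    (hST : S ⊆ T) (h : IsStrongDeformationRetractOf S T) (k : ℕ) :
    Bijective (singularCohomology.map K K
      (subsetInclusion (preimage_mono hST : p ⁻¹' S ⊆ p ⁻¹' T)) k) := by
  obtain ⟨e, he⟩ := h.exists_homotopyEquiv_inclusion hST
  have hw : IsWeakHomotopyEquiv (subsetInclusion hST) := by
    have h1 := isWeakHomotopyEquiv_homotopyEquiv e
    rw [he] at h1
    exact h1
  exact bijective_res_of_isWeakHomotopyEquiv K hp hST hw k

/-- **Restriction `Hᵏ(p⁻¹T) → Hᵏ(p⁻¹b)` to a fibre is bijective over a contractible `T ∋ b`.**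
[cite: Spanier1981, Ch. 9, Sec. 2, Thm. 17] -/
theorem bijective_res_singleton (hp : IsSerreFibration p) {T : Set B} [ContractibleSpace ↥T] {b : B}
    (hb : b ∈ T) (k : ℕ) :
    Bijective (singularCohomology.map K K
      (subsetInclusion (fibre_subset_preimage hb : p ⁻¹' {b} ⊆ p ⁻¹' T)) k) := by
  have hST : ({b} : Set B) ⊆ T := singleton_subset_iff.2 hb
  exact bijective_res_of_isWeakHomotopyEquiv K hp hST
    (SerreCube.isWeakHomotopyEquiv_subsetInclusion_of_contractible hST) k

end WeakEquiv

/-! ### The fibre inside the pullback along a map from a contractible space -/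

section PullbackFibre

variable {E : Type u} {B : Type v} {Y : Type w} [TopologicalSpace E] [TopologicalSpace B]
  [TopologicalSpace Y] {p : E → B}

/-- **Over a contractible parameter space, the fibre includes into the pullback by a weak homotopy
equivalence**: for `φ : Y → B` with `Y` contractible and any map `ι : p⁻¹(φ y₀) → φ^*E` over `y₀`
that is the identity on the `E`-component (the point `y₀` is a weakly contractible sub-base of the
contractible `Y`; Spanier 9.2.17). [cite: Spanier1981, Ch. 9, Sec. 2, Thm. 17] -/
theorem isWeakHomotopyEquiv_fibre_pullback (hp : IsSerreFibration p) (φ : C(Y, B)) [ContractibleSpace Y]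
    (y₀ : Y) (ι : C(↥(p ⁻¹' {φ y₀}), (⇑φ).Pullback p)) (hι : ∀ e, (ι e).snd = e.1)
    (hι' : ∀ e, (ι e).fst = y₀) : IsWeakHomotopyEquiv ι := by
  have hfst := hp.pullback_fst φ
  set S0 : Set Y := {y₀} with hS0
  have h0 : S0 ⊆ univ := subset_univ _
  haveI : ContractibleSpace ↥(univ : Set Y) := (Homeomorph.Set.univ Y).contractibleSpace
  have hw : IsWeakHomotopyEquiv (subsetInclusion h0) :=
    SerreCube.isWeakHomotopyEquiv_subsetInclusion_of_contractible h0
  have h1 := hfst.isWeakHomotopyEquiv_preimage_inclusion h0 hw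
  have hmem : ∀ z : ↥(Function.Pullback.fst ⁻¹' S0 : Set ((⇑φ).Pullback p)),
      p z.1.snd ∈ ({φ y₀} : Set B) := fun z => by
    have hz : z.1.fst = y₀ := z.2
    show p z.1.snd = φ y₀
    rw [← hz]
    exact z.1.2.symm
  let eF : ↥(p ⁻¹' {φ y₀}) ≃ₜ ↥(Function.Pullback.fst ⁻¹' S0 : Set ((⇑φ).Pullback p)) :=
    { toFun := fun e => ⟨ι e, (hι' e : (ι e).fst = y₀)⟩
      invFun := fun z => ⟨z.1.snd, hmem z⟩
      left_inv := fun e => Subtype.ext (hι e)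
      right_inv := fun z => by
        apply Subtype.ext; apply Subtype.ext; apply Prod.ext
        · exact (hι' _).trans (z.2 : z.1.fst = _).symm
        · exact hι _
      continuous_toFun := ι.continuous.subtype_mk _
      continuous_invFun := ((continuous_snd.comp continuous_subtype_val).comp
        continuous_subtype_val).subtype_mk hmem }
  let eU : ↥(Function.Pullback.fst ⁻¹' (univ : Set Y) : Set ((⇑φ).Pullback p)) ≃ₜ (⇑φ).Pullback p :=
    Homeomorph.Set.univ _
  have hfac : ι =
      ((eU : C(↥(Function.Pullback.fst ⁻¹' (univ : Set Y) : Set ((⇑φ).Pullback p)), (⇑φ).Pullback p)).comp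
        (subsetInclusion (preimage_mono h0))).comp
        (eF : C(↥(p ⁻¹' {φ y₀}), ↥(Function.Pullback.fst ⁻¹' S0 : Set ((⇑φ).Pullback p)))) :=
    ContinuousMap.ext fun _ => rfl
  rw [hfac]
  exact ((IsWeakHomotopyEquiv.of_homeomorph eU).comp h1).comp (IsWeakHomotopyEquiv.of_homeomorph eF)

end PullbackFibre

/-! ### Rigidity of flat families along paths -/

section Propagate

variable (K : Type v) [Field K]
variable {E : Type u} {B : Type w} [TopologicalSpace E] [TopologicalSpace B] {p : E → B}

omit [TopologicalSpace B] in
/-- Transport of the fibrewise statement `z|_{p⁻¹b} = y_b` along an equality of base points.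
[folklore] -/
theorem res_eq_iff_of_eq {k : ℕ} {C : Set B} (z : singularCohomology K K ↥(p ⁻¹' C) k)
    (y : ∀ b, singularCohomology K K ↥(p ⁻¹' {b}) k) {b b' : B} (hb : b ∈ C) (hb' : b' ∈ C)
    (e : b = b') :
    (singularCohomology.map K K (subsetInclusion (fibre_subset_preimage hb)) k z = y b ↔
      singularCohomology.map K K (subsetInclusion (fibre_subset_preimage hb')) k z = y b') := by
  subst e
  exact Iff.rfl

/-- **Two fibres of a path inside a neighbourhood carrying a local extension**: for a class
`z ∈ Hᵏ(p⁻¹C)`, a class `g ∈ Hᵏ(p⁻¹V)` restricting to `y_b` on all fibres over `V`, and a path `τ`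
in `C ∩ V`, `z` restricts to `y` on the fibre over `τ t` iff it does over `τ t'`: pull `p` back along
`τ`; all fibres include into the pullback by weak equivalences, and `z - g` pulled back vanishes on
the fibre over `τ s` iff `z|_{p⁻¹(τ s)} = y_{τ s}`. [cite: VoisinHodgeI2002, §9.2.1]
[cite: Spanier1981, Ch. 9, Sec. 2, Thm. 17] -/
theorem propagate_core (hp : IsSerreFibration p) {k : ℕ} {C V : Set B}
    (z : singularCohomology K K ↥(p ⁻¹' C) k) (g : singularCohomology K K ↥(p ⁻¹' V) k)
    (y : ∀ b, singularCohomology K K ↥(p ⁻¹' {b}) k)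
    (hg : ∀ (b : B) (hb : b ∈ V),
      singularCohomology.map K K (subsetInclusion (fibre_subset_preimage hb)) k g = y b)
    (τ : C(I, B)) (hτC : ∀ t, τ t ∈ C) (hτV : ∀ t, τ t ∈ V) (t t' : I) :
    (singularCohomology.map K K (subsetInclusion (fibre_subset_preimage (hτC t))) k z = y (τ t) ↔
      singularCohomology.map K K (subsetInclusion (fibre_subset_preimage (hτC t'))) k z = y (τ t')) := by
  haveI : ContractibleSpace I := (convex_Icc (0 : ℝ) 1).contractibleSpace ⟨0, left_mem_Icc.2 zero_le_one⟩
  have hmemC : ∀ w : (⇑τ).Pullback p, w.snd ∈ p ⁻¹' C := fun w => by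
    have h : p w.snd = τ w.fst := w.2.symm
    show p w.snd ∈ C
    rw [h]; exact hτC _
  have hmemV : ∀ w : (⇑τ).Pullback p, w.snd ∈ p ⁻¹' V := fun w => by
    have h : p w.snd = τ w.fst := w.2.symm
    show p w.snd ∈ V
    rw [h]; exact hτV _
  let sC : C((⇑τ).Pullback p, ↥(p ⁻¹' C)) :=
    ⟨fun w => ⟨w.snd, hmemC w⟩, (continuous_snd.comp continuous_subtype_val).subtype_mk _⟩
  let sV : C((⇑τ).Pullback p, ↥(p ⁻¹' V)) :=
    ⟨fun w => ⟨w.snd, hmemV w⟩, (continuous_snd.comp continuous_subtype_val).subtype_mk _⟩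
  set Δ := singularCohomology.map K K sC k z - singularCohomology.map K K sV k g with hΔ
  let ι : ∀ s : I, C(↥(p ⁻¹' {τ s}), (⇑τ).Pullback p) := fun s =>
    ⟨fun e => ⟨(s, e.1), (e.2 : p e.1 = τ s).symm⟩,
      (continuous_const.prodMk continuous_subtype_val).subtype_mk _⟩
  have key : ∀ s : I,
      (singularCohomology.map K K (subsetInclusion (fibre_subset_preimage (hτC s))) k z = y (τ s) ↔
        Δ = 0) := by
    intro s
    have hinj := (bijective_cohomologyMap_of_isWeakHomotopyEquiv K _
      (isWeakHomotopyEquiv_fibre_pullback hp τ s (ι s) (fun _ => rfl) (fun _ => rfl)) k).1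
    have h1 : sC.comp (ι s) = subsetInclusion (fibre_subset_preimage (hτC s)) :=
      ContinuousMap.ext fun _ => rfl
    have h2 : sV.comp (ι s) = subsetInclusion (fibre_subset_preimage (hτV s)) :=
      ContinuousMap.ext fun _ => rfl
    have hΔs : singularCohomology.map K K (ι s) k Δ =
        singularCohomology.map K K (subsetInclusion (fibre_subset_preimage (hτC s))) k z - y (τ s) := by
      rw [hΔ, map_sub]
      congr 1
      · rw [← ModuleCat.comp_apply, ← singularCohomology.map_comp, h1]
      · rw [← ModuleCat.comp_apply, ← singularCohomology.map_comp, h2, hg (τ s) (hτV s)]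
    constructor
    · intro h
      apply hinj
      rw [hΔs, h, sub_self, map_zero]
    · intro h
      rw [← sub_eq_zero, ← hΔs, h, map_zero]
  exact (key t).trans (key t').symm

/-- **Rigidity of flat families along paths.** Let `y_b ∈ Hᵏ(p⁻¹b; K)` be a flat family (every
point has a neighbourhood `V` and a class on `p⁻¹V` restricting to `y_b` for `b ∈ V`), `C ⊆ B`,
`z ∈ Hᵏ(p⁻¹C; K)` and `γ` a path in `C`. If `z` restricts to `y` on the fibre over `γ 0`, then it
restricts to `y` on the fibre over every `γ t`: the set of such `t` is open and closed
(`propagate_core` on short segments) and `[0, 1]` is connected. (A section of the local system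
`Rᵏ p_* K` that vanishes at one point vanishes along paths; Voisin I §9.2.1, Voisin II §4.3.1.)
[cite: VoisinHodgeII2003, §4.3.1] [cite: VoisinHodgeI2002, §9.2.1] -/
theorem propagate (hp : IsSerreFibration p) {k : ℕ} {C : Set B}
    (z : singularCohomology K K ↥(p ⁻¹' C) k) (y : ∀ b, singularCohomology K K ↥(p ⁻¹' {b}) k)
    (hy : ∀ b₀ : B, ∃ V ∈ 𝓝 b₀, ∃ g : singularCohomology K K ↥(p ⁻¹' V) k, ∀ (b : B) (hb : b ∈ V),
      singularCohomology.map K K (subsetInclusion (fibre_subset_preimage hb)) k g = y b)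
    (γ : C(I, B)) (hγ : ∀ t, γ t ∈ C)
    (h0 : singularCohomology.map K K (subsetInclusion (fibre_subset_preimage (hγ 0))) k z = y (γ 0))
    (t : I) :
    singularCohomology.map K K (subsetInclusion (fibre_subset_preimage (hγ t))) k z = y (γ t) := by
  let Q : I → Prop := fun t =>
    singularCohomology.map K K (subsetInclusion (fibre_subset_preimage (hγ t))) k z = y (γ t)
  -- local constancy of `Q`
  have hloc : ∀ t₀ : I, ∃ U ∈ 𝓝 t₀, ∀ t ∈ U, (Q t ↔ Q t₀) := by
    intro t₀
    obtain ⟨V, hV, g, hg⟩ := hy (γ t₀)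
    have hpre : γ ⁻¹' V ∈ 𝓝 t₀ := γ.continuous.continuousAt.preimage_mem_nhds hV
    obtain ⟨ε, hε, hball⟩ := Metric.mem_nhds_iff.1 hpre
    refine ⟨ball t₀ ε, ball_mem_nhds t₀ hε, fun t ht => ?_⟩
    -- the straight segment from `t₀` to `t`
    have hmemI : ∀ s : I, (1 - (s : ℝ)) * t₀ + (s : ℝ) * t ∈ I := fun s => by
      have h := (convex_Icc (0 : ℝ) 1) t₀.2 t.2 (sub_nonneg.2 s.2.2) s.2.1 (by ring)
      simpa only [smul_eq_mul] using h
    let seg : C(I, I) := ⟨fun s => ⟨(1 - (s : ℝ)) * t₀ + (s : ℝ) * t, hmemI s⟩,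
      Continuous.subtype_mk (by fun_prop) _⟩
    have hseg0 : seg 0 = t₀ := Subtype.ext (by simp [seg])
    have hseg1 : seg 1 = t := Subtype.ext (by simp [seg])
    have hdist : ∀ s, dist (seg s) t₀ ≤ dist t t₀ := fun s => by
      rw [Subtype.dist_eq, Subtype.dist_eq, Real.dist_eq, Real.dist_eq]
      have h : ((seg s : I) : ℝ) - t₀ = (s : ℝ) * ((t : ℝ) - t₀) := by
        show (1 - (s : ℝ)) * t₀ + (s : ℝ) * t - t₀ = _
        ring
      rw [h, abs_mul, abs_of_nonneg s.2.1]
      exact mul_le_of_le_one_left (abs_nonneg _) s.2.2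
    let τ : C(I, B) := γ.comp seg
    have hτV : ∀ s, τ s ∈ V := fun s => hball (lt_of_le_of_lt (hdist s) ht)
    have hcore := propagate_core K hp z g y hg τ (fun s => hγ (seg s)) hτV 1 0
    have e0 : τ 0 = γ t₀ := congrArg γ hseg0
    have e1 : τ 1 = γ t := congrArg γ hseg1
    exact ((res_eq_iff_of_eq K z y (hγ (seg 1)) (hγ t) e1).symm.trans hcore).trans
      (res_eq_iff_of_eq K z y (hγ (seg 0)) (hγ t₀) e0)
  -- `{t | Q t}` is clopen and contains `0`
  have hopen : IsOpen {t | Q t} := by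
    rw [isOpen_iff_mem_nhds]
    intro t₀ ht₀
    obtain ⟨U, hU, hU'⟩ := hloc t₀
    exact Filter.mem_of_superset hU fun t ht => (hU' t ht).2 ht₀
  have hclosed : IsClosed {t | Q t} := by
    rw [← isOpen_compl_iff, isOpen_iff_mem_nhds]
    intro t₀ ht₀
    obtain ⟨U, hU, hU'⟩ := hloc t₀
    exact Filter.mem_of_superset hU fun t ht h => ht₀ ((hU' t ht).1 h)
  haveI : PreconnectedSpace I := Subtype.preconnectedSpace isPreconnected_Icc
  have huniv : {t | Q t} = univ := by
    rcases isClopen_iff.1 ⟨hclosed, hopen⟩ with h | h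
    · exfalso
      have h00 : (0 : I) ∈ {t | Q t} := h0
      rw [h] at h00
      exact h00
    · exact h
  have ht : t ∈ {t | Q t} := by rw [huniv]; exact mem_univ t
  exact ht

/-- `propagate` for a class on the whole total space (`C = univ` read through `E ≃ p⁻¹univ`):
if `z ∈ Hᵏ(E; K)` restricts to `y` on the fibre over `γ 0` then on the fibre over every `γ t`.
[cite: VoisinHodgeII2003, §4.3.1] [cite: VoisinHodgeI2002, §9.2.1] -/
theorem propagate_univ (hp : IsSerreFibration p) {k : ℕ}
    (z : singularCohomology K K E k) (y : ∀ b, singularCohomology K K ↥(p ⁻¹' {b}) k)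
    (hy : ∀ b₀ : B, ∃ V ∈ 𝓝 b₀, ∃ g : singularCohomology K K ↥(p ⁻¹' V) k, ∀ (b : B) (hb : b ∈ V),
      singularCohomology.map K K (subsetInclusion (fibre_subset_preimage hb)) k g = y b)
    (γ : C(I, B)) (h0 : singularCohomology.map K K (subsetIncl (p ⁻¹' {γ 0})) k z = y (γ 0)) (t : I) :
    singularCohomology.map K K (subsetIncl (p ⁻¹' {γ t})) k z = y (γ t) := by
  let eU : ↥(p ⁻¹' (univ : Set B)) ≃ₜ E := Homeomorph.Set.univ E
  let z' : singularCohomology K K ↥(p ⁻¹' (univ : Set B)) k := singularCohomology.map K K (eU : C(_, E)) k z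
  have hfac : ∀ b : B, subsetIncl (p ⁻¹' {b}) =
      (eU : C(_, E)).comp (subsetInclusion (fibre_subset_preimage (mem_univ b))) := fun b =>
    ContinuousMap.ext fun _ => rfl
  have hz' : ∀ b : B, singularCohomology.map K K (subsetInclusion (fibre_subset_preimage (mem_univ b))) k z' =
      singularCohomology.map K K (subsetIncl (p ⁻¹' {b})) k z := fun b => by
    rw [hfac b, singularCohomology.map_comp, ModuleCat.comp_apply]
  rw [← hz']
  refine propagate K hp z' y hy γ (fun t => mem_univ (γ t)) ?_ t
  rw [hz']
  exact h0

end Propagate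

/-! ### Gluing classes on subsets of an ambient space -/

section Glue

variable (K : Type u) [Field K] {M : Type u} [TopologicalSpace M]

/-- **Mayer–Vietoris gluing for two relatively open subsets `A`, `B` of `S ⊆ M`**: classes on `A`
and on `B` with the same restriction to `A ∩ B` are the restrictions of one class on `S`
(Hatcher 2002, §3.1 pp. 203–204, the tree's `singularCohomology.exists_of_map_inclusion_eq`
transported along `↥(S ↓∩ A) ≃ ↥A`). [cite: HatcherAT2002, §3.1 pp. 203–204] -/
theorem exists_of_res_eq_res {S A B : Set M} (hAS : A ⊆ S) (hBS : B ⊆ S)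
    (hA : ∃ A' : Set M, IsOpen A' ∧ A = S ∩ A') (hB : ∃ B' : Set M, IsOpen B' ∧ B = S ∩ B')
    (hcov : S ⊆ A ∪ B) {k : ℕ} (a : singularCohomology K K ↥A k) (b : singularCohomology K K ↥B k)
    (hab : singularCohomology.map K K (subsetInclusion inter_subset_left : C(↥(A ∩ B), ↥A)) k a =
      singularCohomology.map K K (subsetInclusion inter_subset_right : C(↥(A ∩ B), ↥B)) k b) :
    ∃ c : singularCohomology K K ↥S k,
      singularCohomology.map K K (subsetInclusion hAS) k c = a ∧
        singularCohomology.map K K (subsetInclusion hBS) k c = b := by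
  obtain ⟨A', hA'o, hAA'⟩ := hA
  obtain ⟨B', hB'o, hBB'⟩ := hB
  -- the open cover of `↥S`
  let AA : Set ↥S := Subtype.val ⁻¹' A
  let BB : Set ↥S := Subtype.val ⁻¹' B
  have hAAo : IsOpen AA := by
    have : AA = Subtype.val ⁻¹' A' := by
      ext x; constructor
      · intro hx; have h : x.1 ∈ A := hx; rw [hAA'] at h; exact h.2
      · intro hx; show x.1 ∈ A; rw [hAA']; exact ⟨x.2, hx⟩
    rw [this]; exact hA'o.preimage continuous_subtype_val
  have hBBo : IsOpen BB := by
    have : BB = Subtype.val ⁻¹' B' := by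
      ext x; constructor
      · intro hx; have h : x.1 ∈ B := hx; rw [hBB'] at h; exact h.2
      · intro hx; show x.1 ∈ B; rw [hBB']; exact ⟨x.2, hx⟩
    rw [this]; exact hB'o.preimage continuous_subtype_val
  have hcov' : AA ∪ BB = univ := eq_univ_of_forall fun x => hcov x.2
  let eA : ↥AA ≃ₜ ↥A := preimageValHomeomorphOfSubset hAS
  let eB : ↥BB ≃ₜ ↥B := preimageValHomeomorphOfSubset hBS
  let eAB : C(↥(AA ∩ BB), ↥(A ∩ B)) := ⟨fun z => ⟨z.1.1, z.2⟩, by fun_prop⟩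
  let aa := singularCohomology.map K K (eA : C(↥AA, ↥A)) k a
  let bb := singularCohomology.map K K (eB : C(↥BB, ↥B)) k b
  have h1 : (eA : C(↥AA, ↥A)).comp (ContinuousMap.inclusion (inter_subset_left : AA ∩ BB ⊆ AA)) =
      (subsetInclusion inter_subset_left : C(↥(A ∩ B), ↥A)).comp eAB := ContinuousMap.ext fun _ => rfl
  have h2 : (eB : C(↥BB, ↥B)).comp (ContinuousMap.inclusion (inter_subset_right : AA ∩ BB ⊆ BB)) =
      (subsetInclusion inter_subset_right : C(↥(A ∩ B), ↥B)).comp eAB := ContinuousMap.ext fun _ => rfl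
  have hab' : singularCohomology.map K K (ContinuousMap.inclusion (inter_subset_left : AA ∩ BB ⊆ AA)) k aa =
      singularCohomology.map K K (ContinuousMap.inclusion (inter_subset_right : AA ∩ BB ⊆ BB)) k bb := by
    show (singularCohomology.map K K (eA : C(↥AA, ↥A)) k ≫ singularCohomology.map K K _ k) a =
      (singularCohomology.map K K (eB : C(↥BB, ↥B)) k ≫ singularCohomology.map K K _ k) b
    rw [← singularCohomology.map_comp, ← singularCohomology.map_comp, h1, h2,
      singularCohomology.map_comp, singularCohomology.map_comp, ModuleCat.comp_apply,
      ModuleCat.comp_apply, hab]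
  obtain ⟨c, hca, hcb⟩ := singularCohomology.exists_of_map_inclusion_eq K hAAo hBBo hcov' aa bb hab'
  refine ⟨c, ?_, ?_⟩
  · have hf : subsetInclusion hAS = (subsetIncl AA).comp (eA.symm : C(↥A, ↥AA)) := ContinuousMap.ext fun _ => rfl
    rw [hf, singularCohomology.map_comp, ModuleCat.comp_apply, hca]
    exact map_symm_map_homeomorph K eA k a
  · have hf : subsetInclusion hBS = (subsetIncl BB).comp (eB.symm : C(↥B, ↥BB)) := ContinuousMap.ext fun _ => rfl
    rw [hf, singularCohomology.map_comp, ModuleCat.comp_apply, hcb]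
    exact map_symm_map_homeomorph K eB k b

variable {ι : Type w} {O : Set M} {P : ι → Set M} (hPO : ∀ i, P i ⊆ O)

/-- Relatively open, pairwise disjoint, covering pieces of `O ⊆ M` give a clopen partition of `↥O`.
[folklore] -/
theorem isClopenPartition_preimage (hP : ∀ i, ∃ W : Set M, IsOpen W ∧ P i = O ∩ W)
    (hdisj : ∀ i j, i ≠ j → Disjoint (P i) (P j)) (hcov : O ⊆ ⋃ i, P i) :
    IsClopenPartition fun i => (Subtype.val ⁻¹' P i : Set ↥O) := by
  refine IsClopenPartition.of_pairwise_disjoint (fun i => ?_) (fun i j hij => ?_) ?_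
  · obtain ⟨W, hWo, hW⟩ := hP i
    have : (Subtype.val ⁻¹' P i : Set ↥O) = Subtype.val ⁻¹' W := by
      ext x; constructor
      · intro hx; have h : x.1 ∈ P i := hx; rw [hW] at h; exact h.2
      · intro hx; show x.1 ∈ P i; rw [hW]; exact ⟨x.2, hx⟩
    rw [this]; exact hWo.preimage continuous_subtype_val
  · exact (hdisj i j hij).preimage Subtype.val
  · refine eq_univ_of_forall fun x => ?_
    obtain ⟨i, hi⟩ := mem_iUnion.1 (hcov x.2)
    exact mem_iUnion.2 ⟨i, hi⟩

include hPO in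
/-- **A class on `O` vanishing on every piece of a relatively open partition of `O` vanishes**
(additivity of cohomology over disjoint open pieces, Hatcher §3.1 p. 202).
[cite: HatcherAT2002, §3.1 p. 202] -/
theorem eq_zero_of_forall_res_eq_zero (hP : ∀ i, ∃ W : Set M, IsOpen W ∧ P i = O ∩ W)
    (hdisj : ∀ i j, i ≠ j → Disjoint (P i) (P j)) (hcov : O ⊆ ⋃ i, P i) {k : ℕ}
    (c : singularCohomology K K ↥O k)
    (h : ∀ i, singularCohomology.map K K (subsetInclusion (hPO i)) k c = 0) : c = 0 := by
  have hpart := isClopenPartition_preimage hP hdisj hcov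
  refine singularCohomology.eq_zero_of_forall_map_subsetIncl_eq_zero hpart fun i => ?_
  let e : ↥(Subtype.val ⁻¹' P i : Set ↥O) ≃ₜ ↥(P i) := preimageValHomeomorphOfSubset (hPO i)
  have hf : subsetIncl (Subtype.val ⁻¹' P i : Set ↥O) = (subsetInclusion (hPO i)).comp (e : C(_, ↥(P i))) :=
    ContinuousMap.ext fun _ => rfl
  rw [hf, singularCohomology.map_comp, ModuleCat.comp_apply, h i, map_zero]

include hPO in
/-- **Classes on the pieces of a relatively open partition of `O` glue to a class on `O`.**
[cite: HatcherAT2002, §3.1 p. 202] -/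
theorem exists_forall_res_eq (hP : ∀ i, ∃ W : Set M, IsOpen W ∧ P i = O ∩ W)
    (hdisj : ∀ i j, i ≠ j → Disjoint (P i) (P j)) (hcov : O ⊆ ⋃ i, P i) {k : ℕ}
    (c : ∀ i, singularCohomology K K ↥(P i) k) :
    ∃ x : singularCohomology K K ↥O k,
      ∀ i, singularCohomology.map K K (subsetInclusion (hPO i)) k x = c i := by
  have hpart := isClopenPartition_preimage hP hdisj hcov
  let e : ∀ i, ↥(Subtype.val ⁻¹' P i : Set ↥O) ≃ₜ ↥(P i) := fun i => preimageValHomeomorphOfSubset (hPO i)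
  obtain ⟨x, hx⟩ := singularCohomology.exists_forall_map_subsetIncl_eq hpart
    (fun i => singularCohomology.map K K (e i : C(_, ↥(P i))) k (c i))
  refine ⟨x, fun i => ?_⟩
  have hf : subsetInclusion (hPO i) = (subsetIncl (Subtype.val ⁻¹' P i : Set ↥O)).comp ((e i).symm : C(↥(P i), _)) :=
    ContinuousMap.ext fun _ => rfl
  rw [hf, singularCohomology.map_comp, ModuleCat.comp_apply, hx i]
  exact map_symm_map_homeomorph K (e i) k (c i)

end Glue

/-! ### The dual form of an equality of kernels -/

section Dual

variable (K : Type v) [Field K] {A Y Z : Type u} [TopologicalSpace A] [TopologicalSpace Y]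
  [TopologicalSpace Z]

/-- **Over a field, `range (f^* : Hᵏ(Y) → Hᵏ(A)) = range (g^* : Hᵏ(Z) → Hᵏ(A))` as soon as
`ker f_* = ker g_*` on `Hₖ(A)`**: `f^*` is conjugate to the transpose of `f_*` by the bijective
Kronecker maps (Hatcher Thm. 3.2, p. 201), and the range of a transpose is the annihilator of the
kernel. [cite: HatcherAT2002, §3.1 Thm. 3.2 (p. 195) and p. 201] -/
theorem range_cohomologyMap_eq_of_ker_eq (f : C(A, Y)) (g : C(A, Z)) (k : ℕ)
    (h : LinearMap.ker (singularHomology.map K K f k).hom = LinearMap.ker (singularHomology.map K K g k).hom) :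
    LinearMap.range (singularCohomology.map K K f k).hom = LinearMap.range (singularCohomology.map K K g k).hom := by
  have key : ∀ {W : Type u} [TopologicalSpace W] (φ : C(A, W)),
      LinearMap.range (singularCohomology.map K K φ k).hom =
        Submodule.map ((LinearEquiv.ofBijective _ (kroneckerPairing_bijective_of_field K A k)).symm :
            _ →ₗ[K] singularCohomology K K A k)
          (LinearMap.ker (singularHomology.map K K φ k).hom).dualAnnihilator := by
    intro W _ φ
    rw [singularCohomology_map_eq_conj_dualMap_of_field K φ k, LinearMap.range_comp, LinearEquiv.range,
      Submodule.map_top, LinearMap.range_comp, LinearMap.range_dualMap_eq_dualAnnihilator_ker]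
  rw [key f, key g, h]

end Dual

end SerreFlat

end Literature.AlgebraicTopology.Homotopy
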